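import Literature.AnabelianGeometry.AbsoluteAnabelian.AbsTopII.DPSCDataOfEmbedding
import Literature.AnabelianGeometry.AbsoluteAnabelian.AbsTopII.InertiaDecompositionProofs
import Literature.AnabelianGeometry.AbsoluteAnabelian.AbsTopII.InertiaDecompositionProducts
import Literature.AnabelianGeometry.AbsoluteAnabelian.AbsTopII.Prop13vCoveringReduction
import Literature.AnabelianGeometry.AbsoluteAnabelian.FreeProcyclicModel
import Literature.AnabelianGeometry.SemiGraphs.PSCSmoothCurveShape
import Literature.AnabelianGeometry.SemiGraphs.PSCGraphicInner
import Literature.AnabelianGeometry.SemiGraphs.ProSigmaClosedSurfaceSlimCore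
import Mathlib.NumberTheory.Padics.ProperSpace
import Mathlib.Topology.MetricSpace.Ultra.TotallySeparated
import HarnessLib

/-!
# [AbsTopII] Prop 1.3 at a datum WITH CUSPS: the smooth-curve product model `Π_H = Π_𝔾 × Ẑ^Σ`

S. Mochizuki, *Topics in Absolute Anabelian Geometry II* [AbsTopII] (bib `MochizukiAbsTopII2013`; kurims
manuscript `paper:url-585b8d0ad0d9`), §1 Def 1.2 (ii) p. 10, Prop 1.3 pp. 11–12; [CombGC] Prop 1.2 p. 8;
[SemiAnbd] Ex. 2.10 p. 31.  The cell types Prop 1.3 as PREDICATES on abstract DPSC data (abc-iut-L4-t4/t6: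
`DPSCData.Prop13iii/iv′/v/vi/vii/ix`, `DPSCIndexData.Prop_1_3_ii/iii′/v′`; FACT-LIST F-0274 … F-0301),
refutes their universal closures, and PROVES them from printed inputs (`prop_1_3_iii'_of_inputs`,
`prop13v_of_prop_1_3_iii'`, `prop_1_3_v'_of_prop_1_3_iii'`, `prop13vii_of_prop_1_3_ii`, abc-iut-w5-d226's
`prop13*_ofEmbedding`, abc-iut-f-066's `…_of_coverings'`).  The only kernel witness so far that the binder
packages of the (iii′)/(v)/(v′) reductions are JOINTLY satisfiable is the TOY procyclic model `Π_𝔾 = 1`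
(`Prop13ProcyclicModel.lean`), whose docstring names what a non-toy model needs: «a slim non-abelian
`Π_v ⊇ Π_e ≅ Ẑ^Σ` with `Π_e` commensurably terminal».  The tree now has it (layer L3:
`proSigmaSurfaceGroupSlim_holds`, `proSigmaCuspInertiaMalnormal_holds`, `PSCSmoothCurveShape.lean`), and this
PROOF-ONLY file (no definitions) assembles the model (L4-lead RULING #8e, row «P13-NV-CUSP»): `Q` := a
profinite pro-`Σ` completion `ι₀ : Γ_{g,r} → Q` of a HYPERBOLIC punctured surface group with `r ≥ 1` (any
nonempty set of primes `Σ`); `G` := the PSC datum of smooth-curve shape on `Q` (ONE vertex, `Π_v = Q`, no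
nodes, `r` cusps `Π_{c_j} :=` closure of `ι₀⟨c_j⟩`); `Z := Ẑ^Σ = ∏_{p∈Σ} ℤ_p`; `Π_H := Q × Z ⊇ Π_𝔾 := Q × 1`
(abc-iut-w5-d226's `DPSCData.ofEmbedding` at `ι := inl`, i.e. the constructed extension `Π_𝔾 ⋊^out_θ Z` at
the TRIVIAL outer action), `Π_I := Π_H` (log-point base `H = I = Z`).  Then `I_v = 1 × Z ≅ Ẑ^Σ` (since
`Z_{Q×Z}(Q × 1) = Z(Q) × Z` and `Q` is centre-free), `D_v = Π_H`, and EVERY explicit binder of the reductions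
named above holds — hence the typed `Prop_1_3_ii`, `Prop_1_3_iii′`, `Prop13iii`, `Prop13iv′`, `Prop13v`,
`Prop_1_3_v′`, `Prop13vi`, `Prop13vii`, `Prop13ix` ALL hold with NO hypothesis at a datum with `r ≥ 1` CUSPS
and non-abelian slim `Π_𝔾` (the cusp clause of (iii′) non-vacuously: `D_e ∩ Π_I ⊇ Π_e × I_v`, `Π_e ≠ 1`).

HONEST LABEL: by Riemann's existence theorem and the specialisation isomorphism (not in the tree) this is
the DPSC data of a smooth hyperbolic curve of type `(g, r)` over a log point whose `Σ`-inertia acts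
trivially on `Π_𝔾`; inside the tree it is an abstract-group model certifying joint satisfiability of OUR
typings and of the reductions' binder packages — nothing of print beyond that.  Prop 1.3 (i) is not claimed
(the tree's encoding lemma is `Σ = {l}` only).  No side taken on [IUTchIII] Cor 3.12; a witness is
consistency evidence, not an endorsement; typed ≠ proved; constructed ≠ geometric.
-/

noncomputable section

open scoped Pointwise

namespace Literature.AnabelianGeometry.AbsoluteAnabelian

open Literature.AlgebraicGeometry.Frobenioids (IsSlimGroup)
open Literature.AnabelianGeometry.SemiGraphs
open Literature.AnabelianGeometry.SemiGraphs.SemiGraphOfAnabelioids (IsProSigmaCompletion)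
open Literature.GroupTheory.CombinatorialGroupTheory
open Topology

namespace DPSCData

/-! ### Generic lemmas on a direct product `A × B` read through `inl` -/

section ProductHelpers

variable {A B : Type*} [Group A] [Group B]

/-- The image of `inl : A → A × B` is `A × 1`. [cite: MochizukiAbsTopII2013, Def 1.2 (ii) p.10] -/
theorem range_inl_eq_top_prod_bot : (MonoidHom.inl A B).range = (⊤ : Subgroup A).prod ⊥ := by
  ext x
  simp only [MonoidHom.mem_range, MonoidHom.inl_apply, Subgroup.mem_prod, Subgroup.mem_top,
    Subgroup.mem_bot, true_and]
  constructor
  · rintro ⟨a, rfl⟩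
    rfl
  · intro hx
    exact ⟨x.1, Prod.ext rfl hx.symm⟩

/-- **`Z_{A × B}(A × 1) = 1 × B` for centre-free `A`** (the computation `I_v = Z_{Π_I}(Π_v) = 1 × Z` at the
product model, [AbsTopII] Def 1.2 (ii)). [cite: MochizukiAbsTopII2013, Def 1.2 (ii) p.10] -/
theorem centralizer_range_inl_eq_bot_prod_top (hA : Subgroup.center A = ⊥) :
    Subgroup.centralizer ((MonoidHom.inl A B).range : Set (A × B)) = (⊥ : Subgroup A).prod ⊤ := by
  ext x
  rw [Subgroup.mem_centralizer_iff, Subgroup.mem_prod]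
  constructor
  · intro h
    have hc : x.1 ∈ Subgroup.center A := by
      rw [Subgroup.mem_center_iff]
      intro a
      have := congrArg Prod.fst (h (a, 1) ⟨a, rfl⟩)
      simpa using this
    rw [hA, Subgroup.mem_bot] at hc
    exact ⟨hc, Subgroup.mem_top _⟩
  · rintro ⟨h1, -⟩ y hy
    obtain ⟨a, rfl⟩ := MonoidHom.mem_range.mp hy
    rw [Subgroup.mem_bot] at h1
    ext <;> simp [h1]

end ProductHelpers

/-- The closure of a cyclic subgroup of a Hausdorff group is commutative. [folklore] -/
private theorem comm_of_mem_topologicalClosure_zpowers {P : Type*} [Group P] [TopologicalSpace P]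
    [IsTopologicalGroup P] [T2Space P] (b : P) {x y : P}
    (hx : x ∈ (Subgroup.zpowers b).topologicalClosure) (hy : y ∈ (Subgroup.zpowers b).topologicalClosure) :
    x * y = y * x := by
  have hs : ∀ u v : Subgroup.zpowers b, u * v = v * u := by
    rintro ⟨u, hu⟩ ⟨v, hv⟩
    obtain ⟨m, rfl⟩ := Subgroup.mem_zpowers_iff.mp hu
    obtain ⟨n, rfl⟩ := Subgroup.mem_zpowers_iff.mp hv
    exact Subtype.ext (zpow_mul_comm b m n)
  letI := Subgroup.commGroupTopologicalClosure (Subgroup.zpowers b) hs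
  have := mul_comm (⟨x, hx⟩ : (Subgroup.zpowers b).topologicalClosure) ⟨y, hy⟩
  exact congrArg Subtype.val this

end DPSCData

/-! ### The smooth-curve product model -/

namespace AbsTopII.DPSCIndexData

/-- **[AbsTopII] Prop 1.3 (ii), (iii), (iii′), (iv′), (v), (v′), (vi), (vii), (ix) AS TYPED hold with NO
hypothesis at the SMOOTH-CURVE PRODUCT MODEL, together with every binder of the cell's reductions**
(`prop_1_3_iii'_of_inputs`; `prop13v_of_prop_1_3_iii'` / `prop_1_3_v'_of_prop_1_3_iii'` / `prop13vii_of_prop_1_3_ii`;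
`prop13v_of_prop_1_3_iii'_prop13iv'_of_coverings'`; `prop13*_ofEmbedding`): `Σ` any nonempty set of primes,
`(g, r)` hyperbolic with `r ≥ 1`, `Q` a profinite pro-`Σ` completion of `Γ_{g,r}` (slim, infinite), `G` the
one-vertex PSC datum of smooth-curve shape on `Q` with `r` cusps (for which [CombGC] Prop 1.2 (i)(ii) hold),
`Z = ∏_{p∈Σ} ℤ_p ≅ Ẑ^Σ`, `Π_H = Q × Z ⊇ Π_𝔾 = Q × 1 = Π_v`, `Π_I = Π_H`; `I_v ≅ Z`, `D_v = Π_H`, `I_v ∩ Π_𝔾 = 1`.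
Non-vacuity certificate WITH CUSPS and non-abelian slim `Π_𝔾` for the instance forms of FACT-LIST F-0275,
F-0277, F-0278, F-0279, F-0280, F-0298, F-0299, F-0300.  Abstract-group model; constructed ≠ geometric.
[cite: MochizukiAbsTopII2013, Prop 1.3 pp.11-12] [cite: MochizukiCombGC2007, Prop 1.2 p.8] -/
theorem exists_smoothCurve_product_model (Sigma : Set ℕ) (hS₁ : Sigma.Nonempty)
    (hS₂ : ∀ p ∈ Sigma, p.Prime) (g r : ℕ) (hgr : PuncturedSurfaceGroup.IsHyperbolicType g r)
    (hr : 0 < r) :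
    ∃ (Q : ProfiniteGrp.{0}) (ι₀ : PuncturedSurfaceGroup g r →* Q) (_ : IsProSigmaCompletion Sigma ι₀)
      (Z : ProfiniteGrp.{0}) (_ : IsFreeProSigmaCyclic Sigma Z) (G : PSCDatum Q)
      (hιr : IsClosed ((MonoidHom.inl Q Z).range : Set (ProfiniteGrp.of (Q × Z))))
      (hιn : (MonoidHom.inl Q Z).range.Normal) (X : DPSCIndexData.{0}),
      IsSlimGroup Q ∧ Nontrivial Q ∧ G.Sigma = Sigma ∧ IsEmpty G.graph.N ∧ Nonempty G.graph.V ∧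
      (∀ v w : G.graph.V, v = w) ∧ (∀ v, G.vertGp v = ⊤) ∧
      (∃ e : G.graph.C ≃ Fin r, ∀ c, G.cuspGp c =
        ((PuncturedSurfaceGroup.cuspInertia (g := g) (e c)).map ι₀).topologicalClosure) ∧
      G.VerticialEdgeLikeCommensurablyTerminal ∧ G.VerticialOpenInterDeterminesVertex ∧
      G.EdgeLikeOpenInterDeterminesEdge ∧
      (∀ h : (ProfiniteGrp.of (Q × Z) : Type), ∃ φ : Q ≃ₜ* Q,
        (∀ x, h * (MonoidHom.inl Q Z) x * h⁻¹ = (MonoidHom.inl Q Z) (φ x)) ∧ G.IsGraphic G φ) ∧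
      X.toDPSCData = DPSCData.ofEmbedding G (ProfiniteGrp.of (Q × Z)) (MonoidHom.inl Q Z) hιr hιn ⊤
        inferInstance le_top ∧
      X.Sigma = Sigma ∧ X.PiI = ⊤ ∧ Nonempty (X.Cusp ≃ Fin r) ∧ IsEmpty X.Node ∧ Nonempty X.Vert ∧
      (∀ v w : X.Vert, v = w) ∧ Nonempty (Q ≃ₜ* ↥X.PiG) ∧ (∀ v, X.vertSub v = X.PiG) ∧
      (∀ v, X.Dv v = ⊤) ∧ (∀ v, X.Iv v ⊓ X.PiG = ⊥) ∧ (∀ v, Nonempty (Z ≃ₜ* ↥(X.Iv v))) ∧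
      (∀ v, IsCommensurablyTerminal ((X.vertSub v).subgroupOf X.PiG)) ∧
      (∀ e, IsCommensurablyTerminal ((X.cuspSub e).subgroupOf X.PiG)) ∧
      (∀ v, IsSlimGroup ↥(X.vertSub v)) ∧ (∀ v, X.Iv v ⊔ X.PiG = X.PiI) ∧
      (∀ v, IsFreeProSigmaCyclic X.Sigma ↥(X.Iv v)) ∧
      (∀ e, ∃ g₀ : X.PiH, MulAut.conj g₀ • X.Iv (X.cuspVert e) ≤ X.DvCusp e ⊓ X.PiI ∧
        ∀ a ∈ X.IvCusp e, ∀ b ∈ MulAut.conj g₀ • X.Iv (X.cuspVert e), a * b = b * a) ∧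
      (∀ (g₀ : X.PiH) (v : X.Vert), ∃ v' : X.Vert, ∃ γ ∈ X.PiG,
        MulAut.conj g₀ • X.vertSub v = MulAut.conj γ • X.vertSub v') ∧
      (∀ (v v' : X.Vert) (γ : X.PiH), γ ∈ X.PiG →
        (MulAut.conj γ • X.vertSub v' ⊓ X.vertSub v).relIndex (X.vertSub v) ≠ 0 → v' = v) ∧
      (∀ (v : X.Vert) (g₀ : X.PiH), X.Iv v ⊓ MulAut.conj g₀ • X.Iv v ≠ ⊥ →
        MulAut.conj g₀ • X.vertSub v = X.vertSub v) ∧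
      (∀ (g₀ : X.PiH) (e : X.Cusp), ∃ e' : X.Cusp, ∃ γ ∈ X.PiG,
        MulAut.conj g₀ • X.cuspSub e = MulAut.conj γ • X.cuspSub e') ∧
      (∀ (e e' : X.Cusp) (γ : X.PiH), γ ∈ X.PiG →
        (MulAut.conj γ • X.cuspSub e' ⊓ X.cuspSub e).relIndex (X.cuspSub e) ≠ 0 → e' = e) ∧
      (∀ v, IsClosed (X.vertSub v : Set X.PiH)) ∧ IsClosed (X.PiI : Set X.PiH) ∧
      (∀ v, ∀ x ∈ X.Iv v, IsOfFinOrder x → x = 1) ∧ (∀ v, Infinite ↥(X.Iv v)) ∧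
      (∀ N : Subgroup X.PiH, N.Normal → IsOpen (N : Set X.PiH) →
        ∃ J : Subgroup X.PiH, J ≤ N ⊓ X.PiI ∧ J.relIndex X.PiI ≠ 0 ∧
          ∀ (v : X.Vert), ∀ δ ∈ X.PiG,
            Subgroup.centralizer ((X.vertSub v ⊓ (N ⊓ X.PiG) : Subgroup X.PiH) : Set X.PiH) ⊓ J ⊓
                Subgroup.centralizer
                  ((MulAut.conj δ • X.vertSub v ⊓ (N ⊓ X.PiG) : Subgroup X.PiH) : Set X.PiH) ≠ ⊥ →
              δ ∈ X.vertSub v ⊔ (N ⊓ X.PiG)) ∧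
      (∀ e, ∀ x ∈ X.cuspSub e, ∀ y ∈ X.cuspSub e, x * y = y * x) ∧
      X.Prop_1_3_ii ∧ X.Prop_1_3_iii' ∧ X.toDPSCData.Prop13iii ∧ X.toDPSCData.Prop13iv' ∧
      X.toDPSCData.Prop13v ∧ X.Prop_1_3_v' ∧ X.toDPSCData.Prop13vi ∧ X.toDPSCData.Prop13vii ∧
      X.toDPSCData.Prop13ix := by
  classical
  /- the group: a profinite pro-`Σ` completion of `Γ_{g,r}`; slim, hence centre-free -/
  obtain ⟨Q, ι₀, hι₀⟩ := IsProSigmaCompletion.exists_isProSigmaCompletion (PuncturedSurfaceGroup g r) Sigma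
  have hslimQ : IsSlimGroup Q := proSigmaSurfaceGroupSlim_holds Sigma hS₁ hS₂ g r hgr Q ι₀ hι₀
  have hZQ : Subgroup.center (Q : Type) = ⊥ := by
    refine eq_bot_iff.mpr fun z hz => (hslimQ.centralizer_eq_bot ⊤ (by simp)).le ?_
    exact Subgroup.mem_centralizer_iff.mpr fun y _ => Subgroup.mem_center_iff.mp hz y
  have hproQ : IsProSigma Sigma (Q : Type) :=
    ⟨fun U _ p hp hdvd => (hι₀.index_open U.toSubgroup inferInstance U.isOpen').2 p hp hdvd⟩
  /- the PSC datum of smooth-curve shape: one vertex `Π_v = Q`, no nodes, `r` cusps -/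
  let graph : PSCSemiGraph :=
    { V := Unit, N := Empty, C := Fin r, nodeEnds := fun e => e.elim, cuspEnd := fun _ => () }
  let G : PSCDatum Q :=
    { Sigma := Sigma, sigma_prime := hS₂, sigma_nonempty := hS₁, graph := graph, vertGp := fun _ => ⊤,
      nodeGp := fun e => e.elim, genus := fun _ => g,
      cuspGp := fun j => ((PuncturedSurfaceGroup.cuspInertia (g := g) j).map ι₀).topologicalClosure,
      isClosed_vertGp := fun _ => by simp, isClosed_nodeGp := fun e => e.elim,
      isClosed_cuspGp := fun _ => Subgroup.isClosed_topologicalClosure _,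
      nodeGp_le := fun e => e.elim, cuspGp_le := fun _ => ⟨1, le_top⟩, proSigma := hproQ }
  haveI hN0 : IsEmpty G.graph.N := inferInstanceAs (IsEmpty Empty)
  have hVtop : ∀ v, G.vertGp v = ⊤ := fun _ => rfl
  have hCusp : ∀ c, G.cuspGp c =
      ((PuncturedSurfaceGroup.cuspInertia (g := g) ((Equiv.refl _) c)).map ι₀).topologicalClosure := fun _ => rfl
  -- [CombGC] Prop 1.2 (ii) and (i) at smooth-curve shape (layer L3, from cusp-inertia malnormality)
  have hCT : G.VerticialEdgeLikeCommensurablyTerminal :=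
    (G.commensurablyTerminal_of_smoothCurve hS₁ hS₂ hgr ι₀ hι₀ (Equiv.refl _) hCusp hVtop ()).1
  obtain ⟨hDetV, hDet, -⟩ :=
    G.openInterDeterminesComponent_of_smoothCurve hS₁ hS₂ hgr ι₀ hι₀ (Equiv.refl _) hCusp () (fun _ => rfl)
  haveI := G.infinite_cuspGp hS₁ hS₂ hgr ι₀ hι₀ (Equiv.refl _) hCusp (⟨0, hr⟩ : Fin r)
  haveI : Infinite (Q : Type) :=
    Infinite.of_injective (fun x : ↥(G.cuspGp (⟨0, hr⟩ : Fin r)) => (x : Q)) Subtype.val_injective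
  haveI hQnt : Nontrivial (Q : Type) := inferInstance
  let Z : ProfiniteGrp.{0} :=
    ProfiniteGrp.of (Multiplicative (∀ p : {p : Nat.Primes // (p : ℕ) ∈ Sigma}, @PadicInt (p.1 : ℕ) ⟨p.1.2⟩))
  have hZ : IsFreeProSigmaCyclic Sigma Z := isFreeProSigmaCyclic_padicProdOn Sigma
  haveI : Infinite Z := hZ.infinite (hS₂ _ hS₁.some_mem) hS₁.some_mem
  have hZcomm : ∀ a b : Z, a * b = b * a := fun a b =>
    @mul_comm (Multiplicative (∀ p : {p : Nat.Primes // (p : ℕ) ∈ Sigma}, @PadicInt (p.1 : ℕ) ⟨p.1.2⟩)) _ a b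
  /- the extension `Π_H = Q × Z ⊇ Π_𝔾 = Q × 1`, `Π_I = Π_H` -/
  let E : ProfiniteGrp.{0} := ProfiniteGrp.of (Q × Z)
  let ι : (Q : Type) →* (E : Type) := MonoidHom.inl Q Z
  have hιc : Continuous ι := continuous_id.prodMk continuous_const
  have hιi : Function.Injective ι := fun a b h => (Prod.ext_iff.mp h).1
  have hrange : ι.range = (⊤ : Subgroup Q).prod (⊥ : Subgroup Z) := DPSCData.range_inl_eq_top_prod_bot
  have hιr : IsClosed (ι.range : Set E) := by
    rw [hrange, Subgroup.coe_prod, Subgroup.coe_top, Subgroup.coe_bot]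
    exact isClosed_univ.prod isClosed_singleton
  haveI hιn : ι.range.Normal := by rw [hrange]; infer_instance
  let X₀ : DPSCData.{0} := DPSCData.ofEmbedding G E ι hιr hιn ⊤ inferInstance le_top
  let X : DPSCIndexData.{0} :=
    { toDPSCData := X₀, Sigma := Sigma, sigma_prime := ⟨hS₁, hS₂⟩, sigmaIndex := fun n => n.down.elim,
      sigmaIndex_isSigmaInteger := fun n => n.down.elim }
  have hPiG : X.PiG = ι.range := rfl
  have hvert : ∀ v : X.Vert, X.vertSub v = X.PiG := fun v => (MonoidHom.range_eq_map ι).symm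
  have hIv : ∀ v : X.Vert, X.Iv v = (⊥ : Subgroup Q).prod (⊤ : Subgroup Z) := by
    intro v
    show Subgroup.centralizer (X.vertSub v : Set X.PiH) ⊓ ⊤ = _
    rw [inf_top_eq, hvert v, hPiG]
    exact DPSCData.centralizer_range_inl_eq_bot_prod_top hZQ
  have hIvmem : ∀ (v : X.Vert) (x : X.PiH), x ∈ X.Iv v ↔ (x : Q × Z).1 = 1 := by
    intro v x
    rw [hIv v]
    exact ⟨fun hx => Subgroup.mem_bot.mp (Subgroup.mem_prod.mp hx).1,
      fun hx => Subgroup.mem_prod.mpr ⟨Subgroup.mem_bot.mpr hx, Subgroup.mem_top _⟩⟩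
  have hDv : ∀ v : X.Vert, X.Dv v = ⊤ := by
    intro v
    show Subgroup.normalizer (X.vertSub v : Set X.PiH) = ⊤
    rw [hvert v, hPiG]
    exact @Subgroup.normalizer_eq_top _ _ _ hιn
  have hIvc : ∀ (v : X.Vert), ∀ x ∈ X.Iv v, x ∈ Subgroup.center (X.PiH : Type) := by
    intro v x hx
    have hx1 : (x : Q × Z).1 = 1 := (hIvmem v x).mp hx
    rw [Subgroup.mem_center_iff]
    intro y
    apply Prod.ext
    · show (y : Q × Z).1 * (x : Q × Z).1 = (x : Q × Z).1 * (y : Q × Z).1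
      rw [hx1, mul_one, one_mul]
    · show (y : Q × Z).2 * (x : Q × Z).2 = (x : Q × Z).2 * (y : Q × Z).2
      exact hZcomm _ _
  let fIv : ∀ v : X.Vert, Z ≃ₜ* ↥(X.Iv v) := fun v =>
    { toFun := fun z => ⟨((1 : Q), z), (hIvmem v _).mpr rfl⟩
      invFun := fun x => ((x : X.PiH) : Q × Z).2
      left_inv := fun z => rfl
      right_inv := by
        rintro ⟨x, hx⟩
        have hx1 : (x : Q × Z).1 = 1 := (hIvmem v x).mp hx
        apply Subtype.ext
        show (((1 : Q), (x : Q × Z).2) : Q × Z) = x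
        exact Prod.ext hx1.symm rfl
      map_mul' := fun a b => Subtype.ext
        (show (((1 : Q), a * b) : Q × Z) = ((1 : Q), a) * ((1 : Q), b) from Prod.ext (by simp) rfl)
      continuous_toFun := (continuous_const.prodMk continuous_id).subtype_mk _
      continuous_invFun := continuous_snd.comp continuous_subtype_val }
  have hcyc : ∀ v : X.Vert, IsFreeProSigmaCyclic X.Sigma ↥(X.Iv v) := fun v => hZ.of_continuousMulEquiv (fIv v)
  have hinf : ∀ v : X.Vert, Infinite ↥(X.Iv v) := fun v => Infinite.of_injective _ (fIv v).injective
  have hsurj : ∀ v : X.Vert, X.Iv v ⊔ X.PiG = X.PiI := by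
    intro v
    show X.Iv v ⊔ X.PiG = ⊤
    rw [hIv v, hPiG]
    show ((⊥ : Subgroup Q).prod (⊤ : Subgroup Z)) ⊔ (MonoidHom.inl Q Z).range = (⊤ : Subgroup (Q × Z))
    rw [eq_top_iff]
    rintro ⟨q, z⟩ -
    have hx : ((q, z) : Q × Z) = ((1 : Q), z) * (q, 1) := Prod.ext (by simp) (by simp)
    rw [hx]
    exact Subgroup.mul_mem _
      (Subgroup.mem_sup_left (Subgroup.mem_prod.mpr ⟨Subgroup.mem_bot.mpr rfl, Subgroup.mem_top _⟩))
      (Subgroup.mem_sup_right ⟨q, rfl⟩)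
  have hIvG : ∀ v : X.Vert, X.Iv v ⊓ X.PiG = ⊥ := by
    refine fun v => eq_bot_iff.mpr ?_
    rintro x ⟨h1, ⟨a, rfl⟩⟩
    rw [Subgroup.mem_bot, show a = 1 from (hIvmem v _).mp h1, map_one]
    rfl
  -- "(iv) at open subgroups": `Π_v = Π_𝔾` is normal
  have hL : ∀ (v : X.Vert) (g₀ : X.PiH), X.Iv v ⊓ MulAut.conj g₀ • X.Iv v ≠ ⊥ →
      MulAut.conj g₀ • X.vertSub v = X.vertSub v := by
    intro v g₀ _
    rw [hvert v, hPiG, ← toConjAct_smul_subgroup_eq]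
    exact hιn.conjAct _
  -- the cusp clause of (iii′): `I_v = 1 × Z` is central, so it normalises `Π_e` and commutes with it
  have hcusp : ∀ e : X.Cusp, ∃ g₀ : X.PiH,
      MulAut.conj g₀ • X.Iv (X.cuspVert e) ≤ X.DvCusp e ⊓ X.PiI ∧
        ∀ a ∈ X.IvCusp e, ∀ b ∈ MulAut.conj g₀ • X.Iv (X.cuspVert e), a * b = b * a := by
    intro e
    refine ⟨1, ?_, ?_⟩
    · rw [map_one, one_smul]
      intro x hx
      exact ⟨Subgroup.center_le_normalizer _ (hIvc _ x hx), Subgroup.mem_top _⟩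
    · intro a _ b hb
      rw [map_one, one_smul] at hb
      exact (Subgroup.mem_center_iff.mp (hIvc _ b hb)) a
  -- graphicity of the conjugation action: conjugation by `(q, z)` restricts to the INNER `conj q`
  have hconj : ∀ h : E, ∃ φ : Q ≃ₜ* Q, (∀ x, h * ι x * h⁻¹ = ι (φ x)) ∧ G.IsGraphic G φ := by
    rintro ⟨q, z⟩
    let φ : (Q : Type) ≃ₜ* (Q : Type) :=
      { toFun := fun x => q * x * q⁻¹, invFun := fun x => q⁻¹ * x * q, left_inv := fun x => by group,
        right_inv := fun x => by group, map_mul' := fun a b => by group,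
        continuous_toFun := (continuous_const.mul continuous_id).mul continuous_const,
        continuous_invFun := (continuous_const.mul continuous_id).mul continuous_const }
    refine ⟨φ, fun x => ?_, PSCDatum.isGraphic_of_inner G q φ (fun x => rfl)⟩
    show ((q, z) * (x, 1) * (q, z)⁻¹ : Q × Z) = (q * x * q⁻¹, 1)
    exact Prod.ext rfl (show z * 1 * z⁻¹ = 1 by rw [mul_one, mul_inv_cancel])
  -- the cuspidal subgroups are abelian (closures of cyclic groups)
  have hab : ∀ e : X.Cusp, ∀ x ∈ X.cuspSub e, ∀ y ∈ X.cuspSub e, x * y = y * x := by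
    rintro e _ ⟨a, ha, rfl⟩ _ ⟨b, hb, rfl⟩
    change a ∈ ((PuncturedSurfaceGroup.cuspInertia (g := g) e.down).map ι₀).topologicalClosure at ha
    change b ∈ ((PuncturedSurfaceGroup.cuspInertia (g := g) e.down).map ι₀).topologicalClosure at hb
    rw [PuncturedSurfaceGroup.cuspInertia, MonoidHom.map_zpowers] at ha hb
    change (ι a * ι b : E) = (ι b * ι a : E)
    rw [← map_mul, ← map_mul, DPSCData.comm_of_mem_topologicalClosure_zpowers _ ha hb]
  /- the presentation of `X₀` by `G` transported along `Q ≃ₜ* Π_𝔾`: the layer-L3 inputs BY NAME -/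
  obtain ⟨eQ, heQ⟩ := DPSCData.exists_rangeEquiv G E ι hιr hιn ⊤ inferInstance le_top hιc hιi
  have hV' := DPSCData.vertSub_presentation G E ι hιr hιn ⊤ inferInstance le_top heQ
  have hC' := DPSCData.cuspSub_presentation G E ι hιr hιn ⊤ inferInstance le_top heQ
  let G' := G.mapAlong eQ.toMulEquiv.toMonoidHom eQ.continuous G.Sigma subset_rfl G.sigma_nonempty
    (G.proSigma.of_continuousMulEquiv eQ)
  have hCT' : G'.VerticialEdgeLikeCommensurablyTerminal :=
    (PSCDatum.verticialEdgeLikeCommensurablyTerminal_mapAlong_equiv_iff G eQ _ _ _ _).mpr hCT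
  have hDetV' : G'.VerticialOpenInterDeterminesVertex :=
    (PSCDatum.verticialOpenInterDeterminesVertex_mapAlong_equiv_iff G eQ _ _ _ _).mpr hDetV
  have hDet' : G'.EdgeLikeOpenInterDeterminesEdge :=
    (PSCDatum.edgeLikeOpenInterDeterminesEdge_mapAlong_equiv_iff G eQ _ _ _ _).mpr hDet
  have hgr := DPSCData.graphic_presentation G E ι hιr hιn ⊤ inferInstance le_top heQ hconj
  have hCTv := X₀.isCommensurablyTerminal_vertSub_of_psc G' Equiv.ulift hV' hCT'
  have hCTc := X₀.isCommensurablyTerminal_cuspSub_of_psc G' Equiv.ulift hC' hCT'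
  have hGRv := X₀.graphic_vertSub_of_psc G' Equiv.ulift hV' hgr
  have hGRc := X₀.graphic_cuspSub_of_psc G' Equiv.ulift hC' hgr
  have hDetv := X₀.vertDet_of_psc G' Equiv.ulift hV' hDetV'
  have hDetc := X₀.cuspDet_of_psc G' Equiv.ulift hC' hDet'
  let fTop : (Q : Type) ≃ₜ* ↥(⊤ : Subgroup Q) :=
    { (Subgroup.topEquiv : (⊤ : Subgroup Q) ≃* Q).symm with
      continuous_toFun := (continuous_id.subtype_mk _ :
        Continuous fun q : Q => (⟨q, Subgroup.mem_top q⟩ : ↥(⊤ : Subgroup Q)))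
      continuous_invFun := (continuous_subtype_val : Continuous fun q : ↥(⊤ : Subgroup Q) => (q : Q)) }
  have hslimv : ∀ w, IsSlimGroup ↥(G.vertGp w) := fun _ => isSlimGroup_of_continuousMulEquiv fTop hslimQ
  have hslimX : ∀ v : X.Vert, IsSlimGroup ↥(X.vertSub v) := fun v => by
    rw [hvert v]; exact isSlimGroup_of_continuousMulEquiv eQ hslimQ
  have hcl : ∀ v : X.Vert, IsClosed (X.vertSub v : Set X.PiH) := fun v => by rw [hvert v]; exact hιr
  have hIcl : IsClosed (X.PiI : Set X.PiH) := by
    show IsClosed (((⊤ : Subgroup E) : Set E)); rw [Subgroup.coe_top]; exact isClosed_univ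
  have hiii3 : X.toDPSCData.Prop13iii :=
    DPSCData.prop13iii_ofEmbedding G E ι hιc hιi hιr hιn ⊤ inferInstance le_top hCT hslimv hsurj
  have hiii : X.Prop_1_3_iii' := X.prop_1_3_iii'_of_inputs hCTv hCTc hslimX hsurj hcyc hcusp
  haveI : Subsingleton X.Vert := inferInstanceAs (Subsingleton (ULift Unit))
  have hiv' : X.toDPSCData.Prop13iv' :=
    ⟨fun v v' _ _ _ => Or.inl (Subsingleton.elim _ _), fun v v' _ _ _ => Subsingleton.elim _ _⟩
  have hv : X.toDPSCData.Prop13v :=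
    DPSCData.prop13v_ofEmbedding G E ι hιc hιi hιr hιn ⊤ inferInstance le_top hconj hCT hDetV hL hinf
  -- the same conclusion through abc-iut-L4-t6's reduction (its binder package is thereby exercised)
  have _hv₂ : X.toDPSCData.Prop13v := X.prop13v_of_prop_1_3_iii' hiii hGRv hDetv hCTv hL
  have htf : ∀ v : X.Vert, ∀ x ∈ X.Iv v, IsOfFinOrder x → x = 1 :=
    fun v _ hx hfin => X.eq_one_of_isOfFinOrder_of_prop_1_3_iii' hiii hIcl v hx hfin
  have hv' : X.Prop_1_3_v' := X.prop_1_3_v'_of_prop_1_3_iii' hiii hGRv hDetv hCTv hL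
  have hvi : X.toDPSCData.Prop13vi :=
    DPSCData.prop13vi_ofEmbedding G E ι hιc hιi hιr hιn ⊤ inferInstance le_top hconj hCT hDetV
  have hvii : X.toDPSCData.Prop13vii :=
    DPSCData.prop13vii_ofEmbedding G E ι hιc hιi hιr hιn ⊤ inferInstance le_top hconj hCT hDet
      (fun n => n.down.elim)
  -- (vii) once more through abc-iut-L4-t6's reduction from the typed (ii) (vacuous: no nodes)
  have hii : X.Prop_1_3_ii := fun n => n.down.elim
  have _hvii₂ : X.toDPSCData.Prop13vii := X.prop13vii_of_prop_1_3_ii hii (fun _ n => n.down.elim)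
    (fun n => n.down.elim) (fun n => n.down.elim) hGRc hDetc hCTc
  have hix : X.toDPSCData.Prop13ix :=
    DPSCData.prop13ix_ofEmbedding G E ι hιc hιi hιr hιn ⊤ inferInstance le_top hslimQ hconj hCT
      (fun n => n.down.elim) hab
  refine ⟨Q, ι₀, hι₀, Z, hZ, G, hιr, hιn, X, hslimQ, hQnt, rfl, hN0, ⟨()⟩, fun _ _ => rfl, hVtop,
    ⟨Equiv.refl _, hCusp⟩, hCT, hDetV, hDet, hconj, rfl, rfl, rfl, ⟨Equiv.ulift⟩,
    inferInstanceAs (IsEmpty (ULift Empty)), ⟨⟨()⟩⟩, fun _ _ => Subsingleton.elim _ _, ⟨eQ⟩, hvert,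
    hDv, hIvG, fun v => ⟨fIv v⟩, hCTv, hCTc, hslimX, hsurj, hcyc, hcusp, hGRv, hDetv, hL, hGRc, hDetc,
    hcl, hIcl, htf, hinf, ?_, hab, hii, hiii, hiii3, hiv', hv, hv', hvi, hvii, hix⟩
  -- "(iv) at the coverings" (Remark 1.2.1): immediate at one vertex with `Π_v = Π_𝔾` (`J := N`)
  intro N _ hNo
  refine ⟨N, le_inf le_rfl le_top, ?_, fun v δ hδ _ => Subgroup.mem_sup_left (by rw [hvert v]; exact hδ)⟩
  show N.relIndex (⊤ : Subgroup X.PiH) ≠ 0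
  rw [Subgroup.relIndex_top_right]
  haveI : Finite (X.PiH ⧸ N) := Subgroup.quotient_finite_of_isOpen _ hNo
  exact Subgroup.index_ne_zero_of_finite

end AbsTopII.DPSCIndexData

end Literature.AnabelianGeometry.AbsoluteAnabelian

end
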